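/-
HONEST FRAMING: certified error envelopes and provably optimal rounding/accumulation schemes for
low-precision formats under stated cost models; every table by two implementations; no hardware
or vendor claims.
-/
import Mathlib.Algebra.BigOperators.Field
import Summits.Ventures.CertifiedArithmetic.LowPrec.OptDemotionRoutingDeletion
import Summits.Ventures.CertifiedArithmetic.LowPrec.OptDemotionRoutingPair

/-!
# The demotion law (Theorem T8), part 8d: THEOREM R17 — the bit-routing value never beats `treeQf`

OPTIMA.md §B T8(b)(iii⁗) (R17) (opt seat gen 13; paper proof gen13/README §2, certified C30 on 9 008
(tree, knot) pairs at q = 4..7).  For EVERY summation tree `t`, every precision `q ≥ 1`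
(`u = 2^-q`) and every routable configuration `S` of bits with leading bit `e₀ = max S` and at least
one lower bit — i.e. every `q`-bit float `c = Σ_{e ∈ S} 2^e = 2^e₀ (1 + x)`, `0 < x < 1` —

  `u · BR_t(S) ≤ 2^e₀ · (treeQf u t x - 1 - x)`                         (`treeBR_le`, R17(c))

with EQUALITY for one lower bit (`treeBR_pair`, the dyadic knots `x = 2^-i`, R17(c3)) and
`u · BR_t({e₀}) = 2^e₀ · (M_t - 1)` (`treeBR_singleton`).  READING: a carry-free adversary (one
that only routes the bits of the computed value down the tree, injecting at most the half ulp at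
each node) can never push the exact sum of a tree computing `c` above `σ · treeQf(u, t, x)`,
`σ = ufp(c)` — Conjecture (D′), hence (root step, part 6b) Conjecture D `s ≤ Q_t · fl_p(ŝ)`, HOLDS
AGAINST BIT ROUTINGS FOR EVERY TREE; the every-tree witnesses of part 4 are bit routings, so they
are optimal among routings.  What remains of Conjecture D is opt's ROUTING CONJECTURE `W_t = BR_t`
("carries never help", R18; reduced to the two-tree inequality (TT) in R20).

PROOF (new, replacing the family bookkeeping of README §2 by linearity in a formal weight): write
the actual weight `2^e` on the bit families of `S` as the convex combination
`Σ_{i ∈ S∖e₀} (b_i / x) · W_i` (`b_i = 2^i / 2^e₀`, `x = Σ b_i`) of the two-family weights `W_i`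
(`2^e` on the family of `e₀`, `(x 2^e₀ / 2^i) · 2^e` on the family of `i`, `0` elsewhere); then
`BR_t(S) ≤ Σ (b_i/x) · treeBRw W_i S` (sublinearity, part 8a) `≤ Σ (b_i/x) · treeBRw W_i {e₀, i}`
(deletion of the null families, part 8b) `= Σ (b_i/x) · 2^e₀ E_t(x) / u` (two-bit envelope, part
8c, weight ratio `W_i i / W_i e₀ = x`) `= 2^e₀ E_t(x) / u`.
-/

namespace Summit.Ventures.CertifiedArithmetic.LowPrec.Opt

open Literature.ComputerArithmetic.JeannerodRump2018
open Literature.ComputerArithmetic.JeannerodRump2018.SumTree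

/-- THE BIT-ROUTING VALUE `BR_t(S)` of opt gen 13 (R17): the weighted routing value of part 8a
at the actual weight `2^e` (score `ufp` per internal node). -/
def treeBR (q : ℕ) (t : SumTree) (S : Finset ℤ) : ℚ := treeBRw q (fun e => (2 : ℚ) ^ e) t S

/-- `BR_t ≥ 0`. -/
theorem treeBR_nonneg (q : ℕ) (t : SumTree) (S : Finset ℤ) : 0 ≤ treeBR q t S :=
  treeBRw_nonneg (fun e => (zpow_pos (by norm_num) e).le) t S

/-- ONE BIT (R17(c3) at `x = 0`): `u · BR_t({e}) = 2^e · (M_t - 1)`. -/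
theorem treeBR_singleton {q : ℕ} (hq : 1 ≤ q) (t : SumTree) (e : ℤ) :
    unitRoundoff q * treeBR q t {e} = (2 : ℚ) ^ e * (treeM (unitRoundoff q) t - 1) :=
  mul_treeBRw_singleton hq (unitRoundoff_nonneg q) (unitRoundoff_le_one q) (isWeight_zpow q) t e

/-- TWO BITS (R17(c3), EQUALITY AT THE DYADIC KNOTS): for `e₀ - q < e < e₀`,
`u · BR_t({e₀, e}) = 2^e₀ · (treeQf u t x - 1 - x)` with `x = 2^e / 2^e₀ = 2^-(e₀-e)`. -/
theorem treeBR_pair {q : ℕ} (hq : 1 ≤ q) (t : SumTree) {e₀ e : ℤ} (hlt : e < e₀) (hgt : e₀ - q < e) :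
    unitRoundoff q * treeBR q t {e₀, e} =
      (2 : ℚ) ^ e₀ * (treeQf (unitRoundoff q) t ((2 : ℚ) ^ e / (2 : ℚ) ^ e₀) - 1
        - (2 : ℚ) ^ e / (2 : ℚ) ^ e₀) :=
  treeBRw_pair hq (by unfold unitRoundoff; positivity) (unitRoundoff_le_one q) (isWeight_zpow q) t
    e₀ e hlt hgt (zpow_pos (by norm_num) _) (zpow_pos (by norm_num) _)

/-! ## Bit families: residues mod `q` -/

/-- The family relation is invariant under injection (`e ↦ e - q`). -/
theorem dvd_sub_shift_iff (q e e' : ℤ) : q ∣ (e - q) - e' ↔ q ∣ e - e' := by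
  constructor
  · intro h; have := dvd_add h (dvd_refl q); rwa [show e - q - e' + q = e - e' by ring] at this
  · intro h; have := dvd_sub h (dvd_refl q); rwa [show e - e' - q = e - q - e' by ring] at this

/-- In a routable configuration distinct bits lie in distinct families. -/
theorem eq_of_routable_of_dvd {q : ℕ} {S : Finset ℤ} (hS : Routable q S) {e e' : ℤ} (he : e ∈ S)
    (he' : e' ∈ S) (h : (q : ℤ) ∣ e - e') : e = e' := by
  obtain ⟨k, hk⟩ := h
  have h1 := hS e he e' he'
  have h2 := hS e' he' e he
  have hq0 : (0 : ℤ) ≤ q := by positivity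
  rcases lt_trichotomy k 0 with hk0 | hk0 | hk0
  · have : (q : ℤ) * k ≤ -q := by nlinarith
    linarith
  · rw [hk0, mul_zero, sub_eq_zero] at hk; exact hk
  · have : (q : ℤ) ≤ q * k := by nlinarith
    linarith

/-- The families of `e₀` and `i` meet a routable `S ∋ e₀, i` exactly in `{e₀, i}`. -/
theorem filter_two_families {q : ℕ} {S : Finset ℤ} (hS : Routable q S) {e₀ i : ℤ} (h₀ : e₀ ∈ S)
    (hi : i ∈ S) :
    S.filter (fun e' => (q : ℤ) ∣ e' - e₀ ∨ (q : ℤ) ∣ e' - i) = {e₀, i} := by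
  ext y
  simp only [Finset.mem_filter, Finset.mem_insert, Finset.mem_singleton]
  constructor
  · rintro ⟨hy, h | h⟩
    · exact Or.inl (eq_of_routable_of_dvd hS hy h₀ h)
    · exact Or.inr (eq_of_routable_of_dvd hS hy hi h)
  · rintro (rfl | rfl)
    · exact ⟨h₀, Or.inl (by simp)⟩
    · exact ⟨hi, Or.inr (by simp)⟩

/-! ## Theorem R17 -/

section R17

variable {q : ℕ}

/-- The two-family weight of the proof: `2^e` on the family of `e₀`, `r · 2^e` on the family of
`i`, `0` elsewhere. -/
noncomputable def twoFamW (q : ℕ) (e₀ i : ℤ) (r : ℚ) (e : ℤ) : ℚ :=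
  if (q : ℤ) ∣ e - e₀ then (2 : ℚ) ^ e else if (q : ℤ) ∣ e - i then r * (2 : ℚ) ^ e else 0

/-- It vanishes off the two families. -/
theorem twoFamW_null (q : ℕ) (e₀ i : ℤ) (r : ℚ) {e : ℤ}
    (h : ¬ ((q : ℤ) ∣ e - e₀ ∨ (q : ℤ) ∣ e - i)) : twoFamW q e₀ i r e = 0 := by
  unfold twoFamW
  rw [if_neg (fun h' => h (Or.inl h')), if_neg (fun h' => h (Or.inr h'))]

/-- Its value on the family of `e₀`. -/
theorem twoFamW_top (q : ℕ) (e₀ i : ℤ) (r : ℚ) {e : ℤ} (h : (q : ℤ) ∣ e - e₀) :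
    twoFamW q e₀ i r e = (2 : ℚ) ^ e := by
  unfold twoFamW; rw [if_pos h]

/-- Its value on the family of `i` (off the family of `e₀`). -/
theorem twoFamW_low (q : ℕ) (e₀ i : ℤ) (r : ℚ) {e : ℤ} (h₀ : ¬ (q : ℤ) ∣ e - e₀) (h : (q : ℤ) ∣ e - i) :
    twoFamW q e₀ i r e = r * (2 : ℚ) ^ e := by
  unfold twoFamW; rw [if_neg h₀, if_pos h]

/-- It is a weight (`r ≥ 0`). -/
theorem isWeight_twoFamW (q : ℕ) (e₀ i : ℤ) {r : ℚ} (hr : 0 ≤ r) :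
    IsWeight q (unitRoundoff q) (twoFamW q e₀ i r) := by
  have h2 : ∀ e : ℤ, (0 : ℚ) < (2 : ℚ) ^ e := fun e => zpow_pos (by norm_num) e
  have hz : ∀ e : ℤ, (2 : ℚ) ^ (e - q) = unitRoundoff q * (2 : ℚ) ^ e := fun e => by
    simp only [unitRoundoff, one_div]
    rw [zpow_sub₀ (by norm_num), zpow_natCast, div_eq_mul_inv, mul_comm]
  refine ⟨fun e => ?_, fun e => ?_⟩
  · by_cases h₀ : (q : ℤ) ∣ e - e₀
    · rw [twoFamW_top q e₀ i r h₀]; exact (h2 e).le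
    · by_cases hi : (q : ℤ) ∣ e - i
      · rw [twoFamW_low q e₀ i r h₀ hi]; exact mul_nonneg hr (h2 e).le
      · rw [twoFamW_null q e₀ i r (fun h => h.elim h₀ hi)]
  · by_cases h₀ : (q : ℤ) ∣ e - e₀
    · rw [twoFamW_top q e₀ i r h₀, twoFamW_top q e₀ i r ((dvd_sub_shift_iff _ _ _).2 h₀), hz]
    · have h₀' : ¬ (q : ℤ) ∣ (e - q) - e₀ := fun h => h₀ ((dvd_sub_shift_iff _ _ _).1 h)
      by_cases hi : (q : ℤ) ∣ e - i
      · rw [twoFamW_low q e₀ i r h₀ hi, twoFamW_low q e₀ i r h₀' ((dvd_sub_shift_iff _ _ _).2 hi), hz]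
        ring
      · have hi' : ¬ (q : ℤ) ∣ (e - q) - i := fun h => hi ((dvd_sub_shift_iff _ _ _).1 h)
        rw [twoFamW_null q e₀ i r (fun h => h.elim h₀ hi), twoFamW_null q e₀ i r (fun h => h.elim h₀' hi'),
          mul_zero]

/-- **THEOREM R17** (opt gen 13; every tree, every precision, every bit configuration): for a
routable configuration `S` with leading bit `e₀` and at least one lower bit,
`u · BR_t(S) ≤ 2^e₀ · (treeQf u t x - 1 - x)` where `1 + x = (Σ_{e ∈ S} 2^e) / 2^e₀`.
Conjecture (D′) holds against every carry-free (bit-routing) adversary. -/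
theorem treeBR_le (hq : 1 ≤ q) (t : SumTree) {S : Finset ℤ} (hS : Routable q S) (hne : S.Nonempty)
    (hlow : (S.erase (S.max' hne)).Nonempty) :
    unitRoundoff q * treeBR q t S ≤
      (2 : ℚ) ^ (S.max' hne) *
        (treeQf (unitRoundoff q) t ((∑ e ∈ S, (2 : ℚ) ^ e) / (2 : ℚ) ^ (S.max' hne) - 1) - 1 -
          ((∑ e ∈ S, (2 : ℚ) ^ e) / (2 : ℚ) ^ (S.max' hne) - 1)) := by
  -- names
  set u := unitRoundoff q with hudef
  have hu0 : 0 < u := by rw [hudef]; unfold unitRoundoff; positivity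
  have hu1 : u ≤ 1 := unitRoundoff_le_one q
  set e₀ := S.max' hne with he₀def
  have he₀ : e₀ ∈ S := Finset.max'_mem S hne
  set σ : ℚ := (2 : ℚ) ^ e₀ with hσdef
  have hσ : 0 < σ := zpow_pos (by norm_num) _
  set L := S.erase e₀ with hLdef
  set x := (∑ e ∈ S, (2 : ℚ) ^ e) / σ - 1 with hxdef
  have h2pos : ∀ e : ℤ, (0 : ℚ) < (2 : ℚ) ^ e := fun e => zpow_pos (by norm_num) e
  -- x = Σ_{i ∈ L} b_i, b_i = 2^i / σ
  have hxL : x = ∑ i ∈ L, (2 : ℚ) ^ i / σ := by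
    rw [hxdef, ← Finset.add_sum_erase S (fun e => (2 : ℚ) ^ e) he₀, ← hLdef, add_div, Finset.sum_div,
      ← hσdef, div_self hσ.ne']
    ring
  have hx : 0 < x := by
    rw [hxL]; exact Finset.sum_pos (fun i _ => div_pos (h2pos i) hσ) hlow
  -- facts about the lower bits
  have hL : ∀ i ∈ L, i ∈ S ∧ i ≠ e₀ ∧ i < e₀ ∧ e₀ - q < i ∧ ¬ (q : ℤ) ∣ i - e₀ := by
    intro i hi
    have hiS : i ∈ S := Finset.mem_of_mem_erase hi
    have hne' : i ≠ e₀ := Finset.ne_of_mem_erase hi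
    have hle : i ≤ e₀ := Finset.le_max' S i hiS
    refine ⟨hiS, hne', lt_of_le_of_ne hle hne', ?_, fun h => hne' (eq_of_routable_of_dvd hS hiS he₀ h)⟩
    have := hS e₀ he₀ i hiS; linarith
  -- the convex combination of two-family weights: coefficients c_i = b_i / x, Σ c_i = 1
  set c : ℤ → ℚ := fun i => (2 : ℚ) ^ i / σ / x with hcdef
  have hc0 : ∀ i ∈ L, 0 ≤ c i := fun i _ => by
    rw [hcdef]; exact div_nonneg (div_nonneg (h2pos i).le hσ.le) hx.le
  have hc1 : ∑ i ∈ L, c i = 1 := by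
    have : ∑ i ∈ L, c i = (∑ i ∈ L, (2 : ℚ) ^ i / σ) / x := by rw [hcdef, Finset.sum_div]
    rw [this, ← hxL, div_self hx.ne']
  set Wi : ℤ → ℤ → ℚ := fun i => twoFamW q e₀ i (x * σ / (2 : ℚ) ^ i) with hWidef
  -- the actual weight agrees with Σ c_i W_i on every family of S
  have hagree : ∀ e', (∃ s ∈ S, (q : ℤ) ∣ e' - s) → (2 : ℚ) ^ e' = ∑ i ∈ L, c i * Wi i e' := by
    rintro e' ⟨s, hs, hds⟩
    by_cases h₀ : (q : ℤ) ∣ e' - e₀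
    · -- the family of the leading bit: every W_i reads 2^e'
      have : ∀ i ∈ L, c i * Wi i e' = c i * (2 : ℚ) ^ e' := fun i _ => by
        rw [hWidef]; simp only; rw [twoFamW_top q e₀ i _ h₀]
      rw [Finset.sum_congr rfl this, ← Finset.sum_mul, hc1, one_mul]
    · -- the family of a lower bit s: only W_s reads it
      have hs0 : s ≠ e₀ := by
        rintro rfl; exact h₀ hds
      have hsL : s ∈ L := Finset.mem_erase.2 ⟨hs0, hs⟩
      have honly : ∀ i ∈ L, i ≠ s → c i * Wi i e' = 0 := by
        intro i hi his
        have hnot : ¬ (q : ℤ) ∣ e' - i := by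
          intro h
          have : (q : ℤ) ∣ s - i := by
            have := dvd_sub h hds; rwa [show e' - i - (e' - s) = s - i by ring] at this
          exact his (eq_of_routable_of_dvd hS hs (hL i hi).1 this).symm
        rw [hWidef]; simp only
        rw [twoFamW_null q e₀ i _ (fun h => h.elim h₀ hnot), mul_zero]
      rw [Finset.sum_eq_single_of_mem s hsL honly, hWidef]
      simp only
      rw [twoFamW_low q e₀ s _ h₀ hds, hcdef]
      simp only
      field_simp
  -- STEP 1 (locality): BR_t(S) is the value at the weight Σ c_i W_i
  have step1 : treeBR q t S = treeBRw q (fun e' => ∑ i ∈ L, c i * Wi i e') t S := by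
    rw [treeBR]
    refine treeBRw_congr (p := fun e' => ∃ s ∈ S, (q : ℤ) ∣ e' - s) (fun e' ⟨s, hs, h⟩ =>
      ⟨s, hs, (dvd_sub_shift_iff _ _ _).2 h⟩) hagree t S fun e he => ⟨e, he, by simp⟩
  -- STEP 2 (sublinearity)
  have step2 := treeBRw_sum_le (q := q) L c Wi hc0 t S
  -- STEP 3 (deletion) and STEP 4 (two-bit envelope), per lower bit
  have step34 : ∀ i ∈ L, u * treeBRw q (Wi i) t S ≤ σ * (treeQf u t x - 1 - x) := by
    intro i hi
    obtain ⟨hiS, hine, hilt, higt, hindvd⟩ := hL i hi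
    have hr : 0 ≤ x * σ / (2 : ℚ) ^ i := div_nonneg (mul_nonneg hx.le hσ.le) (h2pos i).le
    have hW : IsWeight q u (Wi i) := by rw [hWidef, hudef]; exact isWeight_twoFamW q e₀ i hr
    -- deletion of every family but those of e₀ and i
    have hdel := treeBRw_le_filter (q := q) (W := Wi i) hW.nonneg
      (p := fun e' => (q : ℤ) ∣ e' - e₀ ∨ (q : ℤ) ∣ e' - i)
      (fun e' => by rw [dvd_sub_shift_iff, dvd_sub_shift_iff])
      (fun e' he' => by rw [hWidef]; exact twoFamW_null q e₀ i _ he') t S hS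
    rw [filter_two_families hS he₀ hiS] at hdel
    -- the two-bit envelope at ratio W_i i / W_i e₀ = x
    have hW0 : Wi i e₀ = σ := by rw [hWidef]; simp only; rw [twoFamW_top q e₀ i _ (by simp), hσdef]
    have hWi : Wi i i = x * σ := by
      rw [hWidef]; simp only; rw [twoFamW_low q e₀ i _ hindvd (by simp)]
      field_simp
    have hpair := treeBRw_pair hq hu0 hu1 hW t e₀ i hilt higt (by rw [hW0]; exact hσ)
      (by rw [hWi]; exact mul_pos hx hσ)
    rw [hW0, hWi, mul_div_assoc, div_self hσ.ne', mul_one] at hpair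
    calc u * treeBRw q (Wi i) t S ≤ u * treeBRw q (Wi i) t {e₀, i} :=
          mul_le_mul_of_nonneg_left hdel hu0.le
      _ = σ * (treeQf u t x - 1 - x) := hpair
  -- assemble
  calc u * treeBR q t S = u * treeBRw q (fun e' => ∑ i ∈ L, c i * Wi i e') t S := by rw [step1]
    _ ≤ u * ∑ i ∈ L, c i * treeBRw q (Wi i) t S := mul_le_mul_of_nonneg_left step2 hu0.le
    _ = ∑ i ∈ L, c i * (u * treeBRw q (Wi i) t S) := by rw [Finset.mul_sum]; refine Finset.sum_congr rfl fun i _ => ?_; ring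
    _ ≤ ∑ i ∈ L, c i * (σ * (treeQf u t x - 1 - x)) :=
        Finset.sum_le_sum fun i hi => mul_le_mul_of_nonneg_left (step34 i hi) (hc0 i hi)
    _ = σ * (treeQf u t x - 1 - x) := by rw [← Finset.sum_mul, hc1, one_mul]

end R17

end Summit.Ventures.CertifiedArithmetic.LowPrec.Opt
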